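/-
Origin: expansion seat `prover-pub-hodgecm-mc-binder-2-g11-0`, handover #31 r2 2026-08-20T02:48Z md5 2afc5308dbe8 (88 l.; CERTIFIED rc 0 / 0 warn / 114 s; SUPERSEDES g10 90ea1829dd49 (opens only); **`smooth_wmInputCM₂g`** = the `HypSideW.smooth` field of the W pin of record `wmInputCM₂g V S hGR η hη hηc τ T hT` VERBATIM in the census data, under the sign fact `hW`; `#print axioms` trio) (`HOME/mc/pub-hodgecm-mc-binder-2/g11/pkg/HodgeCM/Model/HypCensus/SmoothPin.lean`, md5 2afc5308dbe8, 88 lines);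
landed by the gen-14 packager (p-g14) in gate run 39 as `HodgeCM/Model/HypCensus/SmoothPin.lean` (verbatim).
-/
/-
Origin: speedrun cell pub-hodgecm, MODEL-CONSTRUCTION sub-cell, lineage mc-binder-2 (BINDER-OWNERS rows 18/19: E binders
`hyp12` / `hyp34` of `Model.perL_picardCM_r15A`), seat prover-pub-hodgecm-mc-binder-2-g10-0 (gen 10), 2026-08-19; r2 binder-2-g11 (opens only).
Target in PKG: `HodgeCM/Model/HypCensus/SmoothPin.lean` (NEW additive leaf; imports this lineage's `HypCensus/SmoothIns` (#28),
`HypCensus/SideW` (#22) and mc-unitary-1's `Model/WmInputInstance` (RUN 37 #5, the W pin of record `wmInputCM₂g`)).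
KERNEL ONLY: 0 records, nothing cited, 0 `def … : Prop`; three theorems.
-/
import Summits.HodgeConjecture.HodgeCM.Model.HypCensus.SmoothIns
import Summits.HodgeConjecture.HodgeCM.Model.HypCensus.SideW
import Summits.HodgeConjecture.HodgeCM.Model.WmInputInstance

/-!
# Census kit (rows A12/A34): the fields `e`, `e_zero`, `smooth` AT THE W PIN OF RECORD `wmInputCM₂g`

`HypCensus/SmoothIns` (#28) closed the census fields `e` / `e_zero` / `smooth` in VALUE currency (`ρ_η = cmPairRepTwist … hGR η`, any
rational set `Γ`).  The W pin of record (model1 (R1″), mc-unitary-1 `Model/WmInputInstance`, RUN 37) is the field-level guarded record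
`W₀ := wmInputCM₂g V S hGR η hη hηc τ T hT`: its Type fields are definitional (`F = L⁺`, `ι = Fin 6`, `eW = cmAdelicEquiv L 2 (diag (dW S))`,
`ΓU × Γ = CMRat × CMRat`) and `W₀.ρ = ρ_η.toHomUnits` under the sign fact `hW` (`wmInputCM₂g_ρ_eq_of`).  This leaf reads #28 on
the pin — the three fields of `HypSideW W₀ jT kind lam hlam m₁ m₂` (#22) in the census data of `HypCensus/Ins` (#27), VERBATIM:

* `e := curveOf V S datum`, `e_zero := curveOf_zero` (W-independent);
* **`smooth_wmInputCM₂g`**: `s⁻¹ • (toTop W₀ (omgW W₀ (curveOf b u s) (ins f φ)) − toTop W₀ (ins f φ)) ⟶ toTop W₀ (ins f (hypX ⟨b,u⟩ φ))`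
  in `ThetaTop`, `s → 0`, `s ≠ 0` — by `rw [wmInputCM₂g_ρ_eq_of … hW]` from #28 `tendsto_toThetaTop_curveOf_ins_sub_div`.

Hypothesis `hW : (∀ j, 0 < (ι₁ (dW S j)).re) ∨ ∀ j, (ι₁ (dW S j)).re < 0` — at a good context
`WGuard.dW_definite_of_thetaModel_goodCtx … hc` (mc-unitary-1).  Nothing here is a claim of PerL/QW8.  Style lint: no `local notation`.
-/

set_option autoImplicit false

noncomputable section

open Filter Topology
open NumberField NumberField.InfinitePlace
open scoped TensorProduct Classical
open Literature.NumberTheory.Automorphic Literature.NumberTheory.Weil1964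
open Literature.NumberTheory.GelbartRogawski1991 Literature.NumberTheory.GelbartRogawski1991.UnitaryDualPair
open Literature.Analysis.SegalBargmann
open HodgeCM HodgeCM.Model HodgeCM.Adelic
open HodgeCM.PerL34.Fock HodgeCM.PerL34.Fock.PrintDict

namespace HodgeCM.Model.HypCensus

section Pin

variable {L : CMField} {ι₁ : L →+* ℂ} (V : HermSpace3 L ι₁) (S : StubTree.SeesawDatum L)
variable
  (hGR : (cmSplittingDatum (L : Type) finProdFinEquiv (frameD V) (frameD_real V) (frameD_ne V) (dW S) (dW_real S) (dW_ne S)).CompatibleSplitting)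
  (η : CMAdelic (L : Type) (frameD V) × CMAdelic (L : Type) (dW S) →* ℂˣ)
  (hη : ∀ γU ∈ CMRat (L : Type) (frameD V), ∀ γ ∈ CMRat (L : Type) (dW S), η (γU, γ) = 1)
  (hηc : Continuous fun p => ((η p : ℂˣ) : ℂ))
  (τ : L →+* ℂ) (T : GL (Fin 3) ℂ)
  (hT : formCongr (starRingEnd ℂ) T (V.Hm.map τ) = Literature.Geometry.ComplexHyperbolic.BallModel.J)
variable (datum : ∀ b : InfinitePlace (L : Type),
  PlaceDatum (L : Type) (frameD V) (frameD_real V) (dW S) (dW_real S) ι₁ (cmPlacesEquiv (L : Type) b))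
variable (m₁ m₂ : InfinitePlace (L : Type) → ℤ)

/-- **field `smooth` of `HypSideW (wmInputCM₂g …)`** in the census data of #27, under the sign fact `hW`: read off #28 by the ONE
value-level read-back `wmInputCM₂g_ρ_eq_of` of the pin (model1 (R2)/(R1″)). -/
theorem smooth_wmInputCM₂g (hW : (∀ j, 0 < (ι₁ ((dW S) j)).re) ∨ ∀ j, (ι₁ ((dW S) j)).re < 0)
    (b : InfinitePlace (L : Type)) (u : HypIdx (kindOf (L : Type) (frameD V) (frameD_real V) (dW S) (dW_real S) ι₁ datum b))
    (f : FinSB ↥(maximalRealSubfield L) (Fin 6))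
    (φ : (printPlaces (InfinitePlace (L : Type)) (kindOf (L : Type) (frameD V) (frameD_real V) (dW S) (dW_real S) ι₁ datum)
      (lamOf (L : Type) (frameD V) (frameD_real V) (dW S) (dW_real S) ι₁ datum)
      (lamOf_ne_zero (L : Type) (frameD V) (frameD_real V) (dW S) (dW_real S) ι₁ datum)
      (pinnedVacs (kindOf (L : Type) (frameD V) (frameD_real V) (dW S) (dW_real S) ι₁ datum) m₁ m₂)).F) :
    Tendsto (fun s : ℝ => ((s : ℝ) : ℂ)⁻¹ •
        (toTop (wmInputCM₂g V S hGR η hη hηc τ T hT)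
            (omgW (wmInputCM₂g V S hGR η hη hηc τ T hT) (curveOf V S datum b u s)
              (ins (L : Type) (frameD V) (frameD_real V) (frameD_ne V) (dW S) (dW_real S) (dW_ne S) ι₁ datum m₁ m₂ f φ)) -
          toTop (wmInputCM₂g V S hGR η hη hηc τ T hT)
            (ins (L : Type) (frameD V) (frameD_real V) (frameD_ne V) (dW S) (dW_real S) (dW_ne S) ι₁ datum m₁ m₂ f φ)))
      (𝓝[≠] 0)
      (𝓝 (toTop (wmInputCM₂g V S hGR η hη hηc τ T hT)
        (ins (L : Type) (frameD V) (frameD_real V) (frameD_ne V) (dW S) (dW_real S) (dW_ne S) ι₁ datum m₁ m₂ f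
          (hypX (InfinitePlace (L : Type)) (kindOf (L : Type) (frameD V) (frameD_real V) (dW S) (dW_real S) ι₁ datum)
            (lamOf (L : Type) (frameD V) (frameD_real V) (dW S) (dW_real S) ι₁ datum)
            (lamOf_ne_zero (L : Type) (frameD V) (frameD_real V) (dW S) (dW_real S) ι₁ datum)
            (pinnedVacs (kindOf (L : Type) (frameD V) (frameD_real V) (dW S) (dW_real S) ι₁ datum) m₁ m₂) ⟨b, u⟩ φ)))) := by
  dsimp only [toTop, thetaTopOf, omgW]
  rw [wmInputCM₂g_ρ_eq_of V S hGR η hη hηc τ T hT hW]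
  exact tendsto_toThetaTop_curveOf_ins_sub_div V S hGR η hηc _ datum m₁ m₂ hW b u f φ

end Pin

end HodgeCM.Model.HypCensus

end
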